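import Mathlib
import Summits.MatrixMultiplication.MatrixMultiplication.Theorems.FourierTwoFamiliesModPPrimeDensityDecayStubHereditaryBias

/-!
# Orbit designs for `ThinPackings`: Parseval for character sums (F2)

Line `automorphism-orbit-twisted-templates` (skeleton `Ideator4Sketch`) of crux
`ThinBlockAlpha.ThinPackings` (stmt-MatrixMultiplication-10595), stub `stub_charParseval` — lemma F2 of
the Fourier-analytic cap on orbit designs.

For a finite set `X` of a finite abelian group `H`, summing over all complex additive characters
`ψ : AddChar H ℂ`,

  `∑_ψ ‖∑_{x ∈ X} ψ x‖² = |H| · |X|`.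

Proof.  `‖s‖² = s · conj s` and `conj (∑_{x ∈ X} ψ x) = ∑_{x ∈ X} ψ (-x)`
(`AddChar.map_neg_eq_conj`: the values of `ψ` are unimodular), so the `ψ`-summand is
`∑_{x, y ∈ X} ψ (x - y)`; swapping the sums, orthogonality `∑_ψ ψ a = |H| · [a = 0]`
(`AddChar.sum_apply_eq_ite`) leaves `∑_{x, y ∈ X} |H| · [x = y] = |H| · |X|`, and the complex
identity is transferred to `ℝ` by `Complex.ofReal` injectivity.

This computation is already landed in the tree (crux `PrimeDensityDecay`, stub `stub_hereditaryBias`)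
as `Summit.MatrixMultiplication.MatrixMultiplication.Theorems.PrimeDensityDecay.HereditaryBias.sum_norm_charSum_sq`
(with the complex form `sum_charSum_mul_charSum_neg`), proved there from Mathlib alone; the registered
stub below is that declaration specialised to `H : Type`.
-/

set_option linter.dupNamespace false  -- `Summit.<S>.<S>.…` is the mandated namespace

namespace Summit.MatrixMultiplication.MatrixMultiplication.Theorems.ThinPackings.Orbit

open Finset
open scoped ComplexConjugate

/-- **F2 (Parseval for character sums).**  For a finite set `X` of a finite abelian group `H`,
`∑_ψ ‖∑_{x ∈ X} ψ x‖² = |H| · |X|`, the sum ranging over all complex additive characters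
`ψ : AddChar H ℂ`.  Registered stub of line `Ideator4Sketch`; it is
`PrimeDensityDecay.HereditaryBias.sum_norm_charSum_sq`. -/
theorem stub_charParseval : ∀ {H : Type} [AddCommGroup H] [Fintype H] [DecidableEq H] (X : Finset H), ∑ ψ : AddChar H ℂ, ‖∑ x ∈ X, ψ x‖ ^ 2 = (Fintype.card H : ℝ) * X.card := by
  intro H _ _ _ X
  exact Summit.MatrixMultiplication.MatrixMultiplication.Theorems.PrimeDensityDecay.HereditaryBias.sum_norm_charSum_sq X

end Summit.MatrixMultiplication.MatrixMultiplication.Theorems.ThinPackings.Orbit
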